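import Summits.CriticalPhenomena.SAWScalingLimit.Theorems.LeftRightFKG.Negative.BoxMesh
import Literature.Probability.LatticeModels.LatticeDobrushinBox
import HarnessLib

/-!
# Negative knowledge on crux `NotFKGAtOne` (stmt-CriticalPhenomena-11233), part 2: the `3 × 3` box as a crux domain

The `3 × 3`-vertex analogue of `LeftRightFKG/Negative/BoxDomain.lean` + `BoxMesh.lean` (same arguments, constants
`[-1,3]²` / `{0,1,2}²`): `sqWalk` = the boundary walk of the square `[-1,3]²` (16 unit steps, counter-clockwise
from `(-1,-1)`), `Ωsq = {z | wind(sqWalk − z) ≠ 0}` exactly as the crux `NotFKGAtOne` builds its domain at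
`δ = 1`; **`meshVertices_Ωsq`** (= the box `{0,1,2}²`: index `1` inside by the crossing formula, junk `0` on the
boundary lattice points, `0` outside the closed square), **`meshDomain_Ωsq`** (connectedness) and
**`dAdj3_iff`**: the crux's domain graph of `sqWalk` is `ℤ²` induced on `{0,1,2}²`.  This is the hypothesis
`AdjBox3` of the disprover's reduction `notFKGAtOne_of_adjBox3` (crux workfile `Cruxes/NotFKGAtOne/Disproof.lean`).
Everything proved. [folklore]
-/

noncomputable section

open Real Set Complex Literature.Probability.LatticeModels Literature.Probability.RandomPlanarGeometry
  Literature.Topology.PlaneTopology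
open Summit.CriticalPhenomena.SAWScalingLimit.Theorems.LeftRightFKG.Negative

namespace Summit.CriticalPhenomena.SAWScalingLimit.Theorems.NotFKGAtOne.Negative

/-! ## The square `[-1,3]²` and its boundary walk -/

/-- The corner `(-1, -1)`. [folklore] -/
abbrev s₀ : Site 2 := bx (-1) (-1)

/-- **The boundary walk of the square `[-1, 3]²`**, counter-clockwise from `(-1,-1)` (16 unit steps). [folklore] -/
def sqWalk : (zdGraph 2).Walk s₀ s₀ :=
  SimpleGraph.Walk.cons (adj_bx (-1) (-1) 0 (-1) (by decide)) (SimpleGraph.Walk.cons (adj_bx 0 (-1) 1 (-1) (by decide))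
  (SimpleGraph.Walk.cons (adj_bx 1 (-1) 2 (-1) (by decide)) (SimpleGraph.Walk.cons (adj_bx 2 (-1) 3 (-1) (by decide))
  (SimpleGraph.Walk.cons (adj_bx 3 (-1) 3 0 (by decide)) (SimpleGraph.Walk.cons (adj_bx 3 0 3 1 (by decide))
  (SimpleGraph.Walk.cons (adj_bx 3 1 3 2 (by decide)) (SimpleGraph.Walk.cons (adj_bx 3 2 3 3 (by decide))
  (SimpleGraph.Walk.cons (adj_bx 3 3 2 3 (by decide)) (SimpleGraph.Walk.cons (adj_bx 2 3 1 3 (by decide))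
  (SimpleGraph.Walk.cons (adj_bx 1 3 0 3 (by decide)) (SimpleGraph.Walk.cons (adj_bx 0 3 (-1) 3 (by decide))
  (SimpleGraph.Walk.cons (adj_bx (-1) 3 (-1) 2 (by decide)) (SimpleGraph.Walk.cons (adj_bx (-1) 2 (-1) 1 (by decide))
  (SimpleGraph.Walk.cons (adj_bx (-1) 1 (-1) 0 (by decide)) (SimpleGraph.Walk.cons (adj_bx (-1) 0 (-1) (-1) (by decide))
  SimpleGraph.Walk.nil)))))))))))))))

/-- The crux's domain for the boundary walk `sqWalk` at `δ = 1`: `Ω = {z | wind(C − z) ≠ 0}`. [folklore] -/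
def Ωsq : Set ℂ :=
  {z | wind (fun t : ℝ => Set.IccExtend zero_le_one (sqWalk.toCurve (meshPoint 1)) t - z) ≠ 0}

/-- The open square `(-1, 3)²`. [folklore] -/
def Sint : Set ℂ := {z | (-1 < z.re ∧ z.re < 3) ∧ (-1 < z.im ∧ z.im < 3)}

/-- The closed square `[-1, 3]²`. [folklore] -/
def Scl : Set ℂ := {z | (-1 ≤ z.re ∧ z.re ≤ 3) ∧ (-1 ≤ z.im ∧ z.im ≤ 3)}

/-- The sites of the box `{0,1,2}²`. [folklore] -/
def box3 : Set (Site 2) := {x | (0 ≤ x 0 ∧ x 0 ≤ 2) ∧ (0 ≤ x 1 ∧ x 1 ≤ 2)}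

/-- `box3` is the tree's `boxSites (0,0) (2,2)`. [folklore] -/
theorem mem_box3_iff_boxSites (x : Site 2) : x ∈ box3 ↔ x ∈ boxSites ![0, 0] ![2, 2] := by
  rw [mem_boxSites_iff, Fin.forall_fin_two]
  simp only [box3, mem_setOf_eq, Matrix.cons_val_zero, Matrix.cons_val_one]

/-- `convex_Sint` (auxiliary). [folklore] -/
theorem convex_Sint : Convex ℝ Sint := by
  have h : Sint = ({z : ℂ | (-1 : ℝ) < z.re} ∩ {z : ℂ | z.re < 3}) ∩ ({z : ℂ | (-1 : ℝ) < z.im} ∩ {z : ℂ | z.im < 3}) := by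
    ext z; simp only [Sint, Set.mem_inter_iff, Set.mem_setOf_eq]
  rw [h]
  exact ((convex_halfSpace_re_gt _).inter (convex_halfSpace_re_lt _)).inter
    ((convex_halfSpace_im_gt _).inter (convex_halfSpace_im_lt _))

/-- `isOpen_Sint` (auxiliary). [folklore] -/
theorem isOpen_Sint : IsOpen Sint := by
  have h : Sint = ({z : ℂ | (-1 : ℝ) < z.re} ∩ {z : ℂ | z.re < 3}) ∩ ({z : ℂ | (-1 : ℝ) < z.im} ∩ {z : ℂ | z.im < 3}) := by
    ext z; simp only [Sint, Set.mem_inter_iff, Set.mem_setOf_eq]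
  rw [h]
  exact ((isOpen_lt continuous_const Complex.continuous_re).inter
    (isOpen_lt Complex.continuous_re continuous_const)).inter
    ((isOpen_lt continuous_const Complex.continuous_im).inter
    (isOpen_lt Complex.continuous_im continuous_const))

/-- `convex_Scl` (auxiliary). [folklore] -/
theorem convex_Scl : Convex ℝ Scl := by
  have h : Scl = ({z : ℂ | (-1 : ℝ) ≤ z.re} ∩ {z : ℂ | z.re ≤ 3}) ∩ ({z : ℂ | (-1 : ℝ) ≤ z.im} ∩ {z : ℂ | z.im ≤ 3}) := by
    ext z; simp only [Scl, Set.mem_inter_iff, Set.mem_setOf_eq]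
  rw [h]
  exact ((convex_halfSpace_re_ge _).inter (convex_halfSpace_re_le _)).inter
    ((convex_halfSpace_im_ge _).inter (convex_halfSpace_im_le _))

/-- `isClosed_Scl` (auxiliary). [folklore] -/
theorem isClosed_Scl : IsClosed Scl := by
  have h : Scl = ({z : ℂ | (-1 : ℝ) ≤ z.re} ∩ {z : ℂ | z.re ≤ 3}) ∩ ({z : ℂ | (-1 : ℝ) ≤ z.im} ∩ {z : ℂ | z.im ≤ 3}) := by
    ext z; simp only [Scl, Set.mem_inter_iff, Set.mem_setOf_eq]
  rw [h]
  exact ((isClosed_le continuous_const Complex.continuous_re).inter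
    (isClosed_le Complex.continuous_re continuous_const)).inter
    ((isClosed_le continuous_const Complex.continuous_im).inter
    (isClosed_le Complex.continuous_im continuous_const))

/-- The crossing count of the boundary walk over the probe of the face `(0,0)`. [folklore] -/
theorem pathCross_sqWalk : pathCross 0 0 s₀ sqWalk.support.tail = -1 := by
  decide

/-! ## Winding numbers of the boundary walk -/

/-- Vertices of the boundary walk have height `≤ 3`. [folklore] -/
theorem sqWalk_support_le3 : ∀ x ∈ sqWalk.support, x 1 ≤ 3 := by decide

/-- `sqWalk_support_bounds` (auxiliary). [folklore] -/
theorem sqWalk_support_bounds :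
    ∀ x ∈ sqWalk.support, (-1 ≤ x 0 ∧ x 0 ≤ 3) ∧ (-1 ≤ x 1 ∧ x 1 ≤ 3) := by decide

/-- `sqWalk_isChain_bdry` (auxiliary). [folklore] -/
theorem sqWalk_isChain_bdry :
    List.IsChain (fun p q : Site 2 => (p 1 = -1 ∧ q 1 = -1) ∨ (p 0 = 3 ∧ q 0 = 3) ∨
      (p 1 = 3 ∧ q 1 = 3) ∨ (p 0 = -1 ∧ q 0 = -1)) (s₀ :: sqWalk.support.tail) := by decide

/-- The loop function of the crux for the boundary walk, as a `Path.extend`. [folklore] -/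
theorem sq_loop_apply (t : ℝ) :
    Set.IccExtend zero_le_one (sqWalk.toCurve (meshPoint 1)) t = (poly s₀ sqWalk.support.tail).extend t :=
  iccExtend_toCurve_apply sqWalk t

/-- **The boundary walk winds once round the centre of the face `(0,0)`.** [folklore] -/
theorem wind_sq_probe :
    wind (fun t : ℝ => (poly s₀ sqWalk.support.tail).extend t - probeL 0 0) = 1 := by
  have h := wind_poly_probeL (m := 0) (k := 0) (Y := 3) (by norm_num) s₀ sqWalk.support.tail
    (isChain_support (fun _ _ h => h) sqWalk) (by decide)
    (fun x hx => sqWalk_support_le3 x (List.mem_of_mem_tail hx)) (poly_fst_walk sqWalk)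
  rw [pathCross_sqWalk] at h
  push_cast at h
  simp only [neg_neg] at h
  exact_mod_cast h

/-- The four boundary lines of the square. [folklore] -/
def Sbd : Set ℂ := {z | z.im = -1 ∨ z.re = 3 ∨ z.im = 3 ∨ z.re = -1}

/-- `segment_subset_Sbd` (auxiliary). [folklore] -/
theorem segment_subset_Sbd {p q : Site 2} (h : (p 1 = -1 ∧ q 1 = -1) ∨ (p 0 = 3 ∧ q 0 = 3) ∨
      (p 1 = 3 ∧ q 1 = 3) ∨ (p 0 = -1 ∧ q 0 = -1)) : segment ℝ (pt p) (pt q) ⊆ Sbd := by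
  intro z hz
  simp only [Sbd, mem_setOf_eq]
  rcases h with ⟨hp, hq⟩ | ⟨hp, hq⟩ | ⟨hp, hq⟩ | ⟨hp, hq⟩
  · left; rw [im_eq_of_mem_segment (by rw [hp, hq]) hz, hp]; norm_num
  · right; left; rw [re_eq_of_mem_segment (by rw [hp, hq]) hz, hp]; norm_num
  · right; right; left; rw [im_eq_of_mem_segment (by rw [hp, hq]) hz, hp]; norm_num
  · right; right; right; rw [re_eq_of_mem_segment (by rw [hp, hq]) hz, hp]; norm_num

/-- `range_sq_subset_Sbd` (auxiliary). [folklore] -/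
theorem range_sq_subset_Sbd : range (poly s₀ sqWalk.support.tail) ⊆ Sbd :=
  range_poly_subset_of_isChain s₀ _ (by simp [Sbd, pt, bx]) (sqWalk_isChain_bdry.imp fun _ _ h => segment_subset_Sbd h)

/-- `Sbd_subset_compl_Sint` (auxiliary). [folklore] -/
theorem Sbd_subset_compl_Sint : Sbd ⊆ Sintᶜ := by
  intro z hz hR
  simp only [Sbd, mem_setOf_eq] at hz
  obtain ⟨⟨h1, h2⟩, h3, h4⟩ := hR
  rcases hz with h | h | h | h <;> linarith

/-- `probeL00_mem_Sint` (auxiliary). [folklore] -/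
theorem probeL00_mem_Sint : probeL 0 0 ∈ Sint := by
  simp only [Sint, mem_setOf_eq, probeL_re, probeL_im]; norm_num

/-- **Inside the square the boundary walk winds once.** [folklore] -/
theorem wind_sq_of_mem_Sint {z : ℂ} (hz : z ∈ Sint) :
    wind (fun t : ℝ => (poly s₀ sqWalk.support.tail).extend t - z) = 1 := by
  rw [← wind_sq_probe]
  symm
  set P := poly s₀ sqWalk.support.tail
  have hK : IsClosed Sintᶜ := isOpen_Sint.isClosed_compl
  have hmaps : MapsTo P.extend (Icc 0 1) Sintᶜ := fun t ht => by
    rw [Path.extend_apply P ht]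
    exact Sbd_subset_compl_Sint (range_sq_subset_Sbd ⟨_, rfl⟩)
  have h01 : P.extend 0 = P.extend 1 := by
    rw [Path.extend_zero, Path.extend_one, poly_fst_walk sqWalk]
  refine wind_sub_eq_of_mem_connectedComponentIn P.continuous_extend.continuousOn h01 hK hmaps ?_
  rw [compl_compl]
  exact convex_Sint.isPreconnected.subset_connectedComponentIn probeL00_mem_Sint Subset.rfl hz

/-- `Sint_subset_Ωsq` (auxiliary). [folklore] -/
theorem Sint_subset_Ωsq : Sint ⊆ Ωsq := fun z hz => by
  simp only [Ωsq, mem_setOf_eq, sq_loop_apply, wind_sq_of_mem_Sint hz]; norm_num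

/-- Lattice points of the boundary walk are not in `Ω` (junk value `0` on the trace). [folklore] -/
theorem not_mem_Ωsq_of_mem_support {x : Site 2} (hx : x ∈ sqWalk.support) : pt x ∉ Ωsq := by
  simp only [Ωsq, mem_setOf_eq, not_not, sq_loop_apply]
  apply wind_eq_zero_of_mem_range
  have hmem : pt x ∈ pt s₀ :: sqWalk.support.tail.map pt := by
    rw [← List.map_cons, sqWalk.cons_tail_support]; exact List.mem_map_of_mem hx
  exact mem_range_polylineFrom _ _ hmem

/-- `range_sq_subset_Scl` (auxiliary). [folklore] -/
theorem range_sq_subset_Scl : range (poly s₀ sqWalk.support.tail) ⊆ Scl := by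
  refine range_poly_subset convex_Scl s₀ _ (by simp [Scl, pt, bx]; norm_num) fun x hx => ?_
  obtain ⟨⟨h1, h2⟩, h3, h4⟩ := sqWalk_support_bounds x (List.mem_of_mem_tail hx)
  simp only [Scl, mem_setOf_eq, pt_re, pt_im]
  refine ⟨⟨?_, ?_⟩, ?_, ?_⟩ <;> assumption_mod_cast

/-- **Outside the closed square the boundary walk does not wind.** [folklore] -/
theorem not_mem_Ωsq_of_not_mem_Scl {z : ℂ} (hz : z ∉ Scl) : z ∉ Ωsq := by
  simp only [Ωsq, mem_setOf_eq, not_not, sq_loop_apply]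
  refine wind_poly_eq_zero_far s₀ _ (poly_fst_walk sqWalk) isClosed_Scl range_sq_subset_Scl hz ?_
  intro M
  have hz' : (z.re < -1 ∨ 3 < z.re) ∨ (z.im < -1 ∨ 3 < z.im) := by
    simp only [Scl, mem_setOf_eq, not_and_or, not_le] at hz
    exact hz
  rcases hz' with (h | h) | (h | h)
  · refine ⟨⟨min z.re 0 - |M| - 1, z.im⟩, ?_, ?_⟩
    · have h1 := abs_re_le_norm (⟨min z.re 0 - |M| - 1, z.im⟩ : ℂ)
      have h2 : (⟨min z.re 0 - |M| - 1, z.im⟩ : ℂ).re = min z.re 0 - |M| - 1 := rfl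
      rw [h2, abs_of_nonpos (by have := min_le_right z.re 0; have := abs_nonneg M; linarith)] at h1
      have := le_abs_self M; have := min_le_right z.re 0; linarith
    · intro y hy hyR
      obtain ⟨-, hhi⟩ := re_mem_of_mem_segment hy
      have hm : max z.re (min z.re 0 - |M| - 1) = z.re :=
        max_eq_left (by have := min_le_left z.re 0; have := abs_nonneg M; linarith)
      rw [show (⟨min z.re 0 - |M| - 1, z.im⟩ : ℂ).re = min z.re 0 - |M| - 1 from rfl, hm] at hhi
      exact absurd hyR.1.1 (by linarith)
  · refine ⟨⟨max z.re 0 + |M| + 1, z.im⟩, ?_, ?_⟩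
    · have h1 := abs_re_le_norm (⟨max z.re 0 + |M| + 1, z.im⟩ : ℂ)
      have h2 : (⟨max z.re 0 + |M| + 1, z.im⟩ : ℂ).re = max z.re 0 + |M| + 1 := rfl
      rw [h2, abs_of_nonneg (by have := le_max_right z.re 0; have := abs_nonneg M; linarith)] at h1
      have := le_abs_self M; have := le_max_right z.re 0; linarith
    · intro y hy hyR
      obtain ⟨hlo, -⟩ := re_mem_of_mem_segment hy
      have hm : min z.re (max z.re 0 + |M| + 1) = z.re :=
        min_eq_left (by have := le_max_left z.re 0; have := abs_nonneg M; linarith)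
      rw [show (⟨max z.re 0 + |M| + 1, z.im⟩ : ℂ).re = max z.re 0 + |M| + 1 from rfl, hm] at hlo
      exact absurd hyR.1.2 (by linarith)
  · refine ⟨⟨z.re, min z.im 0 - |M| - 1⟩, ?_, ?_⟩
    · have h1 := abs_im_le_norm (⟨z.re, min z.im 0 - |M| - 1⟩ : ℂ)
      have h2 : (⟨z.re, min z.im 0 - |M| - 1⟩ : ℂ).im = min z.im 0 - |M| - 1 := rfl
      rw [h2, abs_of_nonpos (by have := min_le_right z.im 0; have := abs_nonneg M; linarith)] at h1
      have := le_abs_self M; have := min_le_right z.im 0; linarith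
    · intro y hy hyR
      obtain ⟨-, hhi⟩ := im_mem_of_mem_segment hy
      have hm : max z.im (min z.im 0 - |M| - 1) = z.im :=
        max_eq_left (by have := min_le_left z.im 0; have := abs_nonneg M; linarith)
      rw [show (⟨z.re, min z.im 0 - |M| - 1⟩ : ℂ).im = min z.im 0 - |M| - 1 from rfl, hm] at hhi
      exact absurd hyR.2.1 (by linarith)
  · refine ⟨⟨z.re, max z.im 0 + |M| + 1⟩, ?_, ?_⟩
    · have h1 := abs_im_le_norm (⟨z.re, max z.im 0 + |M| + 1⟩ : ℂ)
      have h2 : (⟨z.re, max z.im 0 + |M| + 1⟩ : ℂ).im = max z.im 0 + |M| + 1 := rfl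
      rw [h2, abs_of_nonneg (by have := le_max_right z.im 0; have := abs_nonneg M; linarith)] at h1
      have := le_abs_self M; have := le_max_right z.im 0; linarith
    · intro y hy hyR
      obtain ⟨hlo, -⟩ := im_mem_of_mem_segment hy
      have hm : min z.im (max z.im 0 + |M| + 1) = z.im :=
        min_eq_left (by have := le_max_left z.im 0; have := abs_nonneg M; linarith)
      rw [show (⟨z.re, max z.im 0 + |M| + 1⟩ : ℂ).im = max z.im 0 + |M| + 1 from rfl, hm] at hlo
      exact absurd hyR.2.2 (by linarith)

/-- The lattice points of the boundary are vertices of the boundary walk. [folklore] -/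
theorem mem_sq_support_of_bdry (i j : ℤ) (hi : -1 ≤ i) (hi' : i ≤ 3) (hj : -1 ≤ j) (hj' : j ≤ 3)
    (hb : i = -1 ∨ i = 3 ∨ j = -1 ∨ j = 3) : bx i j ∈ sqWalk.support := by
  interval_cases i <;> interval_cases j <;> first | decide | (exfalso; omega)

/-- **The mesh vertices of `Ω` are exactly the sites of the `3 × 3` box.** [folklore] -/
theorem meshVertices_Ωsq : meshVertices Ωsq 1 = box3 := by
  ext x
  rw [mem_meshVertices_iff, LeftRightFKG.Negative.meshPoint_one]
  constructor
  · intro hx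
    by_contra hbox
    by_cases hR : pt x ∈ Scl
    · obtain ⟨⟨h1, h2⟩, h3, h4⟩ := hR
      simp only [pt_re, pt_im] at h1 h2 h3 h4
      have i1 : -1 ≤ x 0 := by exact_mod_cast h1
      have i2 : x 0 ≤ 3 := by exact_mod_cast h2
      have i3 : -1 ≤ x 1 := by exact_mod_cast h3
      have i4 : x 1 ≤ 3 := by exact_mod_cast h4
      have hb : x 0 = -1 ∨ x 0 = 3 ∨ x 1 = -1 ∨ x 1 = 3 := by
        simp only [box3, mem_setOf_eq] at hbox; omega
      have hmem := mem_sq_support_of_bdry (x 0) (x 1) i1 i2 i3 i4 hb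
      rw [← eq_bx x] at hmem
      exact not_mem_Ωsq_of_mem_support hmem hx
    · exact not_mem_Ωsq_of_not_mem_Scl hR hx
  · intro hx
    obtain ⟨⟨h1, h2⟩, h3, h4⟩ := hx
    apply Sint_subset_Ωsq
    simp only [Sint, mem_setOf_eq, pt_re, pt_im]
    have i1 : (0 : ℝ) ≤ x 0 := by exact_mod_cast h1
    have i2 : (x 0 : ℝ) ≤ 2 := by exact_mod_cast h2
    have i3 : (0 : ℝ) ≤ x 1 := by exact_mod_cast h3
    have i4 : (x 1 : ℝ) ≤ 2 := by exact_mod_cast h4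
    refine ⟨⟨by linarith, by linarith⟩, by linarith, by linarith⟩

/-! ## The mesh graph and the discrete domain -/

/-- Box sites lie in the open square. [folklore] -/
theorem pt_mem_Sint_of_box3 {x : Site 2} (hx : x ∈ box3) : pt x ∈ Sint := by
  obtain ⟨⟨h1, h2⟩, h3, h4⟩ := hx
  simp only [Sint, mem_setOf_eq, pt_re, pt_im]
  have i1 : (0 : ℝ) ≤ x 0 := by exact_mod_cast h1
  have i2 : (x 0 : ℝ) ≤ 2 := by exact_mod_cast h2
  have i3 : (0 : ℝ) ≤ x 1 := by exact_mod_cast h3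
  have i4 : (x 1 : ℝ) ≤ 2 := by exact_mod_cast h4
  exact ⟨⟨by linarith, by linarith⟩, by linarith, by linarith⟩

/-- Lattice neighbours inside the box are mesh-adjacent. [folklore] -/
theorem meshGraph_adj_of_box3 {x y : Site 2} (hx : x ∈ box3) (hy : y ∈ box3)
    (h : (zdGraph 2).Adj x y) : (meshGraph Ωsq 1).Adj x y := by
  refine meshGraph_adj_iff.2 ⟨h, ?_⟩
  rw [LeftRightFKG.Negative.meshPoint_one, LeftRightFKG.Negative.meshPoint_one]
  exact (convex_Sint.segment_subset (pt_mem_Sint_of_box3 hx) (pt_mem_Sint_of_box3 hy)).trans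
    (Sint_subset_Ωsq.trans subset_closure)

/-- `bx_mem_box3` (auxiliary). [folklore] -/
theorem bx_mem_box3 {i j : ℤ} (h : (0 ≤ i ∧ i ≤ 2) ∧ (0 ≤ j ∧ j ≤ 2)) : bx i j ∈ box3 := h

/-- **The mesh graph of the box is connected.** [folklore] -/
theorem meshVertexGraph_Ωsq_preconnected : (meshVertexGraph Ωsq 1).Preconnected := by
  have hV := meshVertices_Ωsq
  set G := meshVertexGraph Ωsq 1 with hG
  have h00 : bx 0 0 ∈ meshVertices Ωsq 1 := by rw [hV]; exact bx_mem_box3 (by norm_num)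
  have hrow : ∀ k : ℕ, k ≤ 2 →
      ∃ h : bx k 0 ∈ meshVertices Ωsq 1, G.Reachable ⟨bx 0 0, h00⟩ ⟨bx k 0, h⟩ := by
    intro k hk
    induction k with
    | zero => exact ⟨by exact_mod_cast h00, by exact_mod_cast SimpleGraph.Reachable.refl _⟩
    | succ k ih =>
      obtain ⟨hk', hr⟩ := ih (Nat.le_of_succ_le hk)
      have hmem : bx (k + 1 : ℕ) 0 ∈ meshVertices Ωsq 1 := by
        rw [hV]; exact bx_mem_box3 ⟨⟨by positivity, by exact_mod_cast hk⟩, le_rfl, by norm_num⟩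
      refine ⟨hmem, hr.trans (SimpleGraph.Adj.reachable ?_)⟩
      simp only [hG, SimpleGraph.comap_adj, Function.Embedding.coe_subtype]
      refine meshGraph_adj_of_box3 (hV ▸ hk') (hV ▸ hmem) (adj_bx _ _ _ _ (Or.inl ⟨by push_cast; ring, rfl⟩))
  have hcol : ∀ (i k : ℕ), i ≤ 2 → k ≤ 2 →
      ∃ h : bx i k ∈ meshVertices Ωsq 1, G.Reachable ⟨bx 0 0, h00⟩ ⟨bx i k, h⟩ := by
    intro i k hi hk
    induction k with
    | zero => obtain ⟨h, hr⟩ := hrow i hi; exact ⟨by exact_mod_cast h, by exact_mod_cast hr⟩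
    | succ k ih =>
      obtain ⟨hk', hr⟩ := ih (Nat.le_of_succ_le hk)
      have hmem : bx i (k + 1 : ℕ) ∈ meshVertices Ωsq 1 := by
        rw [hV]; exact bx_mem_box3 ⟨⟨by positivity, by exact_mod_cast hi⟩, by positivity, by exact_mod_cast hk⟩
      refine ⟨hmem, hr.trans (SimpleGraph.Adj.reachable ?_)⟩
      simp only [hG, SimpleGraph.comap_adj, Function.Embedding.coe_subtype]
      refine meshGraph_adj_of_box3 (hV ▸ hk') (hV ▸ hmem) (adj_bx _ _ _ _ (Or.inr (Or.inr (Or.inl ⟨by push_cast; ring, rfl⟩))))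
  have hreach : ∀ v : meshVertices Ωsq 1, G.Reachable ⟨bx 0 0, h00⟩ v := by
    rintro ⟨v, hv⟩
    have hv' := hv
    rw [hV] at hv'
    obtain ⟨⟨h1, h2⟩, h3, h4⟩ := hv'
    obtain ⟨i, hi⟩ : ∃ i : ℕ, (i : ℤ) = v 0 := ⟨(v 0).toNat, Int.toNat_of_nonneg h1⟩
    obtain ⟨k, hk⟩ : ∃ k : ℕ, (k : ℤ) = v 1 := ⟨(v 1).toNat, Int.toNat_of_nonneg h3⟩
    have hiL : i ≤ 2 := by omega
    have hkL : k ≤ 2 := by omega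
    obtain ⟨h, hr⟩ := hcol i k hiL hkL
    have heq : bx i k = v := by rw [eq_bx v, ← hi, ← hk]
    have hsub : (⟨v, hv⟩ : meshVertices Ωsq 1) = ⟨bx i k, h⟩ := Subtype.ext heq.symm
    rw [hsub]
    exact hr
  exact fun u v => (hreach u).symm.trans (hreach v)

/-- **The discrete domain of `Ω` is the whole box.** [folklore] -/
theorem meshDomain_Ωsq : meshDomain Ωsq 1 = box3 := by
  rw [Literature.Probability.Percolation.meshDomain_eq_meshVertices_of_preconnected
    meshVertexGraph_Ωsq_preconnected, meshVertices_Ωsq]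

/-- **Adjacency in the crux's domain graph of `sqWalk`** is lattice adjacency inside the box `{0,1,2}²`. [folklore] -/
theorem dAdj3_iff {x y : Site 2} :
    (discreteDomainGraph Ωsq 1).Adj x y ↔ (zdGraph 2).Adj x y ∧ x ∈ box3 ∧ y ∈ box3 := by
  rw [discreteDomainGraph_adj_iff, meshDomain_Ωsq]
  constructor
  · rintro ⟨h, hx, hy⟩
    exact ⟨meshGraph_le_zdGraph _ _ h, hx, hy⟩
  · rintro ⟨h, hx, hy⟩
    exact ⟨meshGraph_adj_of_box3 hx hy h, hx, hy⟩

/-- The same, with the tree's `boxSites (0,0) (2,2)` (the form `BoundaryTP2Negative_Box3` enumerates over). [folklore] -/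
theorem dAdj3_iff_boxSites (x y : Site 2) :
    (discreteDomainGraph Ωsq 1).Adj x y ↔
      (zdGraph 2).Adj x y ∧ x ∈ boxSites ![0, 0] ![2, 2] ∧ y ∈ boxSites ![0, 0] ![2, 2] := by
  rw [dAdj3_iff, mem_box3_iff_boxSites, mem_box3_iff_boxSites]

end Summit.CriticalPhenomena.SAWScalingLimit.Theorems.NotFKGAtOne.Negative
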